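import Summits.Ventures.PercRepro.MSTightClosure

/-!
# Tight families with a down-closed difference family are products: down-set × up-set

`MSTightDichotomy.lean` (Theorem D) shows that a Marica–Schönheim-tight family `F`
(`|F \\ F| = |F|`) whose difference family `F \\ F` is a down-set has, at every coordinate `s`,
either every member avoiding `s` extended by `s` in `F` (`s` ADDABLE) or every member containing
`s` with its deletion in `F` (`s` DELETABLE); `MSTightClosure.lean` records the closure of `F`
under adding addable and deleting deletable coordinates, with `M = addableSet u F` the addable
class of a support `u`. This file closes the step «D at every coordinate ⇒ product»:

* `flip M F = {A ∆ M : A ∈ F}` (symmetric difference with the addable class) is a DOWN-SET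
  (`isDownSet_flip`), because deleting an element of `W = A ∆ M` means deleting a deletable
  coordinate from `A` or adding an addable one (`symmDiff_sdiff_symmDiff`);
* every difference of members of `F` splits as `(W \ V) \ M ∪ (V \ W) ∩ M` in terms of the flipped
  members (`sdiff_eq_of_symmDiff`), so `F \\ F` is exactly the family of unions `X ∪ Y` with
  `X ∈ flip M F`, `X ⊆ u \ M`, `Y ∈ flip M F`, `Y ⊆ M` (`diffs_eq_sups_within`);
* that product has `|{X}| · |{Y}|` members (`card_sups_of_disjoint`), it contains `flip M F`,
  and `|flip M F| = |F| = |F \\ F|` — so `flip M F` IS the product (`flip_eq_sups_within`), and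
  flipping back, **`tight_eq_sups_of_isDownSet`**: `F = L ⊻ U` with `L` a down-set of subsets of
  `u \ M` and `U` an up-set of subsets of `M` (the complements in `M` of a down-set), and
  `F \\ F = L ⊻ (M − U)`.

Combined with p4's Theorem D (`exists_downSet_upSet_of_tight_of_isDownSet`): a tight family with
down-closed differences is a product of a down-set on its deletable coordinates and an up-set on
its addable coordinates — the converse being immediate. (Paper: proofs/MINE1-singlemerge.md §17,
«THE FLIP»; the general characterisation without the down-set hypothesis is Theorem S there.)
-/

namespace PercRepro.MSTight

open Finset
open scoped FinsetFamily symmDiff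

variable {α : Type*} [DecidableEq α]

/-- The **flip** of a family along a coordinate set `M`: every member `A` is replaced by `A ∆ M`. -/
def flip (M : Finset α) (F : Finset (Finset α)) : Finset (Finset α) := F.image fun A => A ∆ M

/-- Membership in the flip: `W ∈ flip M F` iff `W = A ∆ M` for a member `A`. -/
theorem mem_flip {M : Finset α} {F : Finset (Finset α)} {W : Finset α} :
    W ∈ flip M F ↔ ∃ A ∈ F, A ∆ M = W := by
  simp [flip]

/-- The flip of a member is in the flip. -/
theorem symmDiff_mem_flip {M : Finset α} {F : Finset (Finset α)} {A : Finset α} (hA : A ∈ F) :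
    A ∆ M ∈ flip M F :=
  mem_flip.2 ⟨A, hA, rfl⟩

/-- Flipping a member of the flip back along `M` lands in `F`. -/
theorem symmDiff_mem_of_mem_flip {M : Finset α} {F : Finset (Finset α)} {W : Finset α}
    (hW : W ∈ flip M F) : W ∆ M ∈ F := by
  obtain ⟨A, hA, rfl⟩ := mem_flip.1 hW
  rw [symmDiff_symmDiff_cancel_right]
  exact hA

/-- Flipping twice along the same `M` is the identity. -/
theorem flip_flip (M : Finset α) (F : Finset (Finset α)) : flip M (flip M F) = F := by
  ext W
  constructor
  · intro hW
    have h2 := symmDiff_mem_of_mem_flip (symmDiff_mem_of_mem_flip hW)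
    rwa [symmDiff_symmDiff_cancel_right] at h2
  · intro hW
    exact mem_flip.2 ⟨W ∆ M, symmDiff_mem_flip hW, symmDiff_symmDiff_cancel_right _ _⟩

/-- The flip has as many members as `F` (symmetric difference with `M` is injective). -/
theorem card_flip (M : Finset α) (F : Finset (Finset α)) : (flip M F).card = F.card :=
  card_image_of_injective _ (symmDiff_left_injective M)

/-- Members of the flip of a family supported on `u` along `M ⊆ u` are subsets of `u`. -/
theorem subset_of_mem_flip {u M : Finset α} {F : Finset (Finset α)} (hFu : ∀ A ∈ F, A ⊆ u)
    (hMu : M ⊆ u) {W : Finset α} (hW : W ∈ flip M F) : W ⊆ u := by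
  obtain ⟨A, hA, rfl⟩ := mem_flip.1 hW
  intro s hs
  rcases mem_symmDiff.1 hs with ⟨h, _⟩ | ⟨h, _⟩
  · exact hFu A hA h
  · exact hMu h

/-- Deleting `Z` from `A ∆ M` and flipping back deletes `Z \ M` from `A` and adds `Z ∩ M`. -/
theorem symmDiff_sdiff_symmDiff (A M Z : Finset α) :
    (A ∆ M \ Z) ∆ M = (A \ (Z \ M)) ∪ (Z ∩ M) := by
  ext s
  simp only [mem_symmDiff, mem_sdiff, mem_union, mem_inter]
  by_cases hM : s ∈ M <;> by_cases hA : s ∈ A <;> by_cases hZ : s ∈ Z <;> simp [hM, hA, hZ]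

/-- A difference of members, in terms of the flipped members `W = A ∆ M`, `V = B ∆ M`. -/
theorem sdiff_eq_of_symmDiff (A B M : Finset α) :
    A \ B = ((A ∆ M \ B ∆ M) \ M) ∪ ((B ∆ M \ A ∆ M) ∩ M) := by
  ext s
  simp only [mem_symmDiff, mem_sdiff, mem_union, mem_inter]
  by_cases hM : s ∈ M <;> by_cases hA : s ∈ A <;> by_cases hB : s ∈ B <;> simp [hM, hA, hB]

/-- If the coordinates of `M` are addable and those of `u \ M` deletable, the flip along `M` of a
family supported on `u` is a down-set. -/
theorem isDownSet_flip {u M : Finset α} {F : Finset (Finset α)} (hFu : ∀ A ∈ F, A ⊆ u)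
    (hMu : M ⊆ u) (hadd : ∀ s ∈ M, Addable F s) (hdel : ∀ s ∈ u, s ∉ M → Deletable F s) :
    IsDownSet (flip M F) := by
  intro W hW W' hW'
  obtain ⟨A, hA, rfl⟩ := mem_flip.1 hW
  have hW'eq : W' = A ∆ M \ (A ∆ M \ W') := by
    ext s
    simp only [mem_sdiff, not_and, not_not]
    constructor
    · intro h; exact ⟨hW' h, fun _ => h⟩
    · rintro ⟨h1, h2⟩; exact h2 h1
  have hB : (A ∆ M \ (A ∆ M \ W')) ∆ M ∈ F := by
    rw [symmDiff_sdiff_symmDiff]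
    have h1 : A \ ((A ∆ M \ W') \ M) ∈ F := by
      refine sdiff_mem_of_deletable hA _ fun s hs => ?_
      have hsM : s ∉ M := (mem_sdiff.1 hs).2
      have hsW : s ∈ A ∆ M := (mem_sdiff.1 (mem_sdiff.1 hs).1).1
      have hsu : s ∈ u := by
        rcases mem_symmDiff.1 hsW with ⟨h, _⟩ | ⟨h, _⟩
        · exact hFu A hA h
        · exact hMu h
      exact hdel s hsu hsM
    exact union_mem_of_addable h1 _ fun s hs => hadd s (mem_inter.1 hs).2
  rw [hW'eq]
  exact mem_flip.2 ⟨_, hB, symmDiff_symmDiff_cancel_right _ _⟩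

/-- The members of `G` contained in `N`. -/
def within (G : Finset (Finset α)) (N : Finset α) : Finset (Finset α) := G.filter fun X => X ⊆ N

/-- Membership in `within G N`. -/
theorem mem_within {G : Finset (Finset α)} {N X : Finset α} :
    X ∈ within G N ↔ X ∈ G ∧ X ⊆ N := by
  simp [within]

/-- The members of a down-set inside `N` form a down-set. -/
theorem isDownSet_within {G : Finset (Finset α)} (hG : IsDownSet G) (N : Finset α) :
    IsDownSet (within G N) := by
  intro X hX X' hX'
  obtain ⟨hXG, hXN⟩ := mem_within.1 hX
  exact mem_within.2 ⟨hG X hXG X' hX', hX'.trans hXN⟩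

/-- The differences of `F` are exactly the unions `X ∪ Y` of a flipped member `X ⊆ u \ M` and a
flipped member `Y ⊆ M`. -/
theorem diffs_eq_sups_within {u M : Finset α} {F : Finset (Finset α)} (hFu : ∀ A ∈ F, A ⊆ u)
    (hMu : M ⊆ u) (hG : IsDownSet (flip M F)) :
    F \\ F = within (flip M F) (u \ M) ⊻ within (flip M F) M := by
  ext E
  constructor
  · intro hE
    obtain ⟨A, hA, B, hB, rfl⟩ := mem_diffs.1 hE
    rw [sdiff_eq_of_symmDiff A B M]
    refine mem_sups.2 ⟨_, mem_within.2 ⟨hG _ (symmDiff_mem_flip hA) _ ?_, ?_⟩,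
      _, mem_within.2 ⟨hG _ (symmDiff_mem_flip hB) _ ?_, ?_⟩, sup_eq_union⟩
    · exact sdiff_subset.trans sdiff_subset
    · intro s hs
      obtain ⟨hs1, hs2⟩ := mem_sdiff.1 hs
      exact mem_sdiff.2 ⟨subset_of_mem_flip hFu hMu (symmDiff_mem_flip hA) (mem_sdiff.1 hs1).1, hs2⟩
    · exact inter_subset_left.trans sdiff_subset
    · exact inter_subset_right
  · intro hE
    obtain ⟨X, hX, Y, hY, rfl⟩ := mem_sups.1 hE
    obtain ⟨hXG, hXN⟩ := mem_within.1 hX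
    obtain ⟨hYG, hYM⟩ := mem_within.1 hY
    refine mem_diffs.2 ⟨X ∆ M, symmDiff_mem_of_mem_flip hXG, Y ∆ M, symmDiff_mem_of_mem_flip hYG, ?_⟩
    rw [sdiff_eq_of_symmDiff (X ∆ M) (Y ∆ M) M, symmDiff_symmDiff_cancel_right,
      symmDiff_symmDiff_cancel_right, sup_eq_union]
    ext s
    simp only [mem_union, mem_sdiff, mem_inter]
    constructor
    · rintro (⟨⟨hs, _⟩, _⟩ | ⟨⟨hs, _⟩, _⟩)
      · exact Or.inl hs
      · exact Or.inr hs
    · rintro (hs | hs)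
      · have hsM : s ∉ M := (mem_sdiff.1 (hXN hs)).2
        exact Or.inl ⟨⟨hs, fun h => hsM (hYM h)⟩, hsM⟩
      · have hsM : s ∈ M := hYM hs
        exact Or.inr ⟨⟨hs, fun h => (mem_sdiff.1 (hXN h)).2 hsM⟩, hsM⟩

/-- Unions of members of two families on disjoint supports are pairwise distinct. -/
theorem card_sups_of_disjoint {S T : Finset (Finset α)} {N M : Finset α} (hNM : Disjoint N M)
    (hS : ∀ X ∈ S, X ⊆ N) (hT : ∀ Y ∈ T, Y ⊆ M) : (S ⊻ T).card = S.card * T.card := by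
  have key : ∀ X Y : Finset α, X ⊆ N → Y ⊆ M → (X ∪ Y) ∩ N = X ∧ (X ∪ Y) ∩ M = Y := by
    intro X Y hX hY
    constructor
    · ext s
      simp only [mem_inter, mem_union]
      constructor
      · rintro ⟨hs | hs, hsN⟩
        · exact hs
        · exact absurd hsN (Finset.disjoint_right.1 hNM (hY hs))
      · intro hs; exact ⟨Or.inl hs, hX hs⟩
    · ext s
      simp only [mem_inter, mem_union]
      constructor
      · rintro ⟨hs | hs, hsM⟩
        · exact absurd hsM (Finset.disjoint_left.1 hNM (hX hs))
        · exact hs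
      · intro hs; exact ⟨Or.inr hs, hY hs⟩
  change (image₂ (· ⊔ ·) S T).card = S.card * T.card
  rw [card_image₂_iff]
  rintro ⟨X, Y⟩ hXY ⟨X', Y'⟩ hXY' h
  simp only [Set.mem_prod, mem_coe] at hXY hXY'
  simp only [sup_eq_union] at h
  obtain ⟨h1, h2⟩ := key X Y (hS X hXY.1) (hT Y hXY.2)
  obtain ⟨h1', h2'⟩ := key X' Y' (hS X' hXY'.1) (hT Y' hXY'.2)
  have hX : X = X' := by rw [← h1, ← h1', h]
  have hY : Y = Y' := by rw [← h2, ← h2', h]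
  rw [hX, hY]

/-- **The flip is the product**: for a tight `F` supported on `u` whose flip along `M ⊆ u` is a
down-set, `flip M F` consists exactly of the unions `X ∪ Y` with `X, Y ∈ flip M F`, `X ⊆ u \ M`,
`Y ⊆ M`. -/
theorem flip_eq_sups_within {u M : Finset α} {F : Finset (Finset α)} (hF : Tight F)
    (hFu : ∀ A ∈ F, A ⊆ u) (hMu : M ⊆ u) (hG : IsDownSet (flip M F)) :
    flip M F = within (flip M F) (u \ M) ⊻ within (flip M F) M := by
  apply eq_of_subset_of_card_le
  · intro W hW
    have hWu : W ⊆ u := subset_of_mem_flip hFu hMu hW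
    refine mem_sups.2 ⟨W ∩ (u \ M), mem_within.2 ⟨hG _ hW _ inter_subset_left, inter_subset_right⟩,
      W ∩ M, mem_within.2 ⟨hG _ hW _ inter_subset_left, inter_subset_right⟩, ?_⟩
    rw [sup_eq_union]
    ext s
    simp only [mem_union, mem_inter, mem_sdiff]
    constructor
    · rintro (⟨hs, _⟩ | ⟨hs, _⟩) <;> exact hs
    · intro hs
      by_cases hsM : s ∈ M
      · exact Or.inr ⟨hs, hsM⟩
      · exact Or.inl ⟨hs, hWu hs, hsM⟩
  · rw [← diffs_eq_sups_within hFu hMu hG, card_flip]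
    exact le_of_eq hF

/-- The complements within `M` of the members of `H`. -/
def complWithin (M : Finset α) (H : Finset (Finset α)) : Finset (Finset α) := H.image fun Y => M \ Y

/-- Membership in `complWithin M H`. -/
theorem mem_complWithin {M : Finset α} {H : Finset (Finset α)} {Y' : Finset α} :
    Y' ∈ complWithin M H ↔ ∃ Y ∈ H, M \ Y = Y' := by
  simp [complWithin]

/-- A family of subsets of `M` is an **up-set within `M`** when it is closed under enlarging a
member inside `M`. -/
def IsUpSetWithin (M : Finset α) (H : Finset (Finset α)) : Prop :=
  ∀ Y ∈ H, ∀ Y' ⊆ M, Y ⊆ Y' → Y' ∈ H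

/-- The complements within `M` of a down-set of subsets of `M` form an up-set within `M`. -/
theorem isUpSetWithin_complWithin {M : Finset α} {H : Finset (Finset α)} (hH : IsDownSet H) :
    IsUpSetWithin M (complWithin M H) := by
  intro Y' hY' Y'' hY''M hsub
  obtain ⟨Y, hY, rfl⟩ := mem_complWithin.1 hY'
  have hmem : M \ Y'' ∈ H := by
    refine hH Y hY _ fun s hs => ?_
    obtain ⟨hsM, hsY''⟩ := mem_sdiff.1 hs
    by_contra hsY
    exact hsY'' (hsub (mem_sdiff.2 ⟨hsM, hsY⟩))
  refine mem_complWithin.2 ⟨M \ Y'', hmem, ?_⟩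
  exact Finset.sdiff_sdiff_eq_self hY''M

/-- **A tight family with a down-closed flip is a product**: `F = L ⊻ U` with `L` the flipped
members inside `u \ M` (a down-set) and `U` the complements within `M` of the flipped members
inside `M` (an up-set within `M`). -/
theorem tight_eq_sups_of_isDownSet {u M : Finset α} {F : Finset (Finset α)} (hF : Tight F)
    (hFu : ∀ A ∈ F, A ⊆ u) (hMu : M ⊆ u) (hG : IsDownSet (flip M F)) :
    F = within (flip M F) (u \ M) ⊻ complWithin M (within (flip M F) M) := by
  have hprod := flip_eq_sups_within hF hFu hMu hG
  ext A
  constructor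
  · intro hA
    have hW : A ∆ M ∈ flip M F := symmDiff_mem_flip hA
    rw [hprod] at hW
    obtain ⟨X, hX, Y, hY, hXY⟩ := mem_sups.1 hW
    obtain ⟨_, hXN⟩ := mem_within.1 hX
    obtain ⟨_, hYM⟩ := mem_within.1 hY
    refine mem_sups.2 ⟨X, hX, M \ Y, mem_complWithin.2 ⟨Y, hY, rfl⟩, ?_⟩
    rw [sup_eq_union] at hXY ⊢
    -- A = (A ∆ M) ∆ M = (X ∪ Y) ∆ M = X ∪ (M \ Y)
    have hAeq : A = (X ∪ Y) ∆ M := by rw [hXY, symmDiff_symmDiff_cancel_right]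
    rw [hAeq]
    ext s
    simp only [mem_symmDiff, mem_union, mem_sdiff]
    constructor
    · rintro (hs | ⟨hsM, hsY⟩)
      · exact Or.inl ⟨Or.inl hs, (mem_sdiff.1 (hXN hs)).2⟩
      · exact Or.inr ⟨hsM, fun h => h.elim (fun h' => (mem_sdiff.1 (hXN h')).2 hsM) hsY⟩
    · rintro (⟨hs | hs, hsM⟩ | ⟨hsM, hs⟩)
      · exact Or.inl hs
      · exact absurd (hYM hs) hsM
      · exact Or.inr ⟨hsM, fun h => hs (Or.inr h)⟩
  · intro hA
    obtain ⟨X, hX, Y', hY', hXY⟩ := mem_sups.1 hA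
    obtain ⟨Y, hY, rfl⟩ := mem_complWithin.1 hY'
    obtain ⟨hXG, hXN⟩ := mem_within.1 hX
    obtain ⟨hYG, hYM⟩ := mem_within.1 hY
    have hmem : X ∪ Y ∈ flip M F := by
      rw [hprod]
      exact mem_sups.2 ⟨X, hX, Y, hY, sup_eq_union⟩
    have hA' : (X ∪ Y) ∆ M ∈ F := symmDiff_mem_of_mem_flip hmem
    rw [sup_eq_union] at hXY
    rw [← hXY]
    convert hA' using 1
    ext s
    simp only [mem_symmDiff, mem_union, mem_sdiff]
    constructor
    · rintro (hs | ⟨hsM, hsY⟩)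
      · exact Or.inl ⟨Or.inl hs, (mem_sdiff.1 (hXN hs)).2⟩
      · exact Or.inr ⟨hsM, fun h => h.elim (fun h' => (mem_sdiff.1 (hXN h')).2 hsM) hsY⟩
    · rintro (⟨hs | hs, hsM⟩ | ⟨hsM, hs⟩)
      · exact Or.inl hs
      · exact absurd (hYM hs) hsM
      · exact Or.inr ⟨hsM, fun h => hs (Or.inr h)⟩

open Classical in
/-- **Theorem D + the flip**: a tight family with a down-closed difference family, supported on
`u`, is the product of a down-set `L` of subsets of `u \ M` and an up-set `U` within `M`, where
`M = addableSet u F` is its addable class; moreover `F \\ F = L ⊻ (M − U)`. -/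
theorem exists_downSet_upSet_of_tight_of_isDownSet {u : Finset α} {F : Finset (Finset α)}
    (hF : Tight F) (hD : IsDownSet (F \\ F)) (hFu : ∀ A ∈ F, A ⊆ u) :
    ∃ M ⊆ u, ∃ L U : Finset (Finset α), IsDownSet L ∧ (∀ X ∈ L, X ⊆ u \ M) ∧
      IsUpSetWithin M U ∧ (∀ Y ∈ U, Y ⊆ M) ∧ F = L ⊻ U ∧ F \\ F = L ⊻ complWithin M U := by
  set M := addableSet u F with hM
  have hMu : M ⊆ u := fun s hs => (mem_addableSet.1 hs).1
  have hG : IsDownSet (flip M F) :=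
    isDownSet_flip hFu hMu (fun s hs => (mem_addableSet.1 hs).2)
      (fun s hs hsM => deletable_of_notMem_addableSet hF hD hs hsM)
  refine ⟨M, hMu, within (flip M F) (u \ M), complWithin M (within (flip M F) M),
    isDownSet_within hG _, fun X hX => (mem_within.1 hX).2,
    isUpSetWithin_complWithin (isDownSet_within hG M),
    ?_, tight_eq_sups_of_isDownSet hF hFu hMu hG, ?_⟩
  · intro Y' hY'
    obtain ⟨Y, _, rfl⟩ := mem_complWithin.1 hY'
    exact sdiff_subset
  · rw [diffs_eq_sups_within hFu hMu hG]
    congr 1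
    ext Y
    constructor
    · intro hY
      refine mem_complWithin.2 ⟨M \ Y, ?_, Finset.sdiff_sdiff_eq_self (mem_within.1 hY).2⟩
      exact mem_complWithin.2 ⟨Y, hY, rfl⟩
    · intro hY
      obtain ⟨Y', hY', rfl⟩ := mem_complWithin.1 hY
      obtain ⟨Y'', hY'', rfl⟩ := mem_complWithin.1 hY'
      rw [Finset.sdiff_sdiff_eq_self (mem_within.1 hY'').2]
      exact hY''

end PercRepro.MSTight
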